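import Mathlib
import HarnessLib
import Summits.HubbardSuperconductivity.HubbardSuperconductivity.Theorems.KLProgrammeH10TwoPointLimitPerturbedCountDeriv

/-!
# Route `KLProgramme` — crux K1 `H10TwoPointLimit` (stmt-HubbardSuperconductivity-19938):
# the covering lemma of the sector count ON THE PERTURBED CURVE (BGM App. A2 region `R₁` on the moving curve)

Second port step of HOME/prover-p4/PORT-NOTE.md, and the DEMONSTRATION of its architecture (β): the tree's covering lemma
`BandSectorCounting.cover` («if `|h| ≤ η₀` and both partials `|∂₂h|, |∂₃h| ≤ λ` then `θ₃ ≡ θ₂ (mod π)` up to `τ`») is transported to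
the perturbed level function `h^E` of `KLProgrammePerturbedCountDefs.lean` WITHOUT re-proving any geometry: the momentum sum `S` with
`|ε₂(S) + δ(S) - μ| ≤ η₀` is `η₀`-close to the FREE curve of the shifted level `μ' = μ - δ(S)` (`exists_near_curve_trig` at `μ'`), each leg
`p_E(θᵢ)` IS a free point of its shifted level `νᵢ` with velocity within `κ₁ C_V` of the free one (`abs_VXE_sub_bandVX_le`), the `Dδ`-term
of `∂ᵢ h^E` is `≤ κ₁ S_E`, and the level gaps `|μ' - νᵢ| ≤ 2κ₀` move the sines by `≤ 2κ₀/Dt_min`; so the free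
`exists_int_near_of_cross_small` applies AT THE LEVEL `νᵢ` with the threshold enlarged by `O(κ₀ + κ₁)` — which the fixed tolerance `τ`
absorbs (`cover_perturbed`; the smallness hypothesis is the tree's `hcov` with `λ/2 + 2 s_max η₀/Dt_min` replaced by the explicit
`ε₄ = λ/2 + κ₁ S_E/2 + 2κ₁ C_V + 2 s_max η₀/Dt_min + 4 s_max κ₀/Dt_min`, `C_V = (π√2 + 2 s_max)/(Dt_min - κ₁)`, `S_E = s_max + κ₁ C_V`).
Here `δ` is bounded with bounded gradient on ALL of `ℝ²` (for the `2π`-periodic perturbations of the programme — BGM's `E_h - ε₀`, the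
`C₄ᵥ` frames — this is the bound on one cell), since the momentum sum leaves the square.

Everything is PROVED; no definitions. References: BGM 2006 App. A2 (the region `R₁`), App. A3 p.37 [cite: BenfattoGiulianiMastropietro2006].
-/

noncomputable section

namespace Summit.HubbardSuperconductivity.HubbardSuperconductivity.Theorems.PerturbedFermiCurve

set_option linter.dupNamespace false -- summit = problem name (single-conjunct summit), D-0017

open Real Set
open Literature.MathematicalPhysics.QuantumLattice Literature.MathematicalPhysics.QuantumLattice.BandSectorCounting

section Cover

variable {a b : ℝ} (B : BandBounds a b) {δ : (Fin 2 → ℝ) → ℝ} {n : WithTop ℕ∞} (hδs : ContDiff ℝ n δ) (hn : n ≠ 0)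
  {κ₀ κ₁ μ : ℝ} (hδ : ∀ k : Fin 2 → ℝ, |δ k| ≤ κ₀) (hlo : a ≤ μ - κ₀) (hhi : μ + κ₀ ≤ b)
  (hκ : ∀ k : Fin 2 → ℝ, ‖fderiv ℝ δ k‖ ≤ κ₁) (hκ₁ : κ₁ < B.Dtmin)
  {u : ℝ → ℝ} (hu : ∀ θ, IsBandFermiRadius (μ - δ (u θ • dir θ)) θ (u θ))
include B hδs hn hδ hlo hhi hκ hκ₁ hu

/-- **The cross quantity of a perturbed leg, reduced to the free one at the shifted level.** For any reals `p, q` with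
`|p|, |q| ≤ 1` (the sines of the sum point): `|p·VX_ν(θ) + q·VY_ν(θ)| ≤ |p·X_E'(θ) + q·Y_E'(θ)| + 2κ₁ C_V`, `ν` the shifted level of
the leg. [folklore] -/
theorem abs_cross_band_le_cross_E {p q : ℝ} (hp : |p| ≤ 1) (hq : |q| ≤ 1) (θ : ℝ) :
    |p * bandVX (μ - δ (u θ • dir θ)) θ + q * bandVY (μ - δ (u θ • dir θ)) θ| ≤
      |p * VXE u θ + q * VYE u θ| + 2 * (κ₁ * (π * Real.sqrt 2 + 2 * B.smax) / (B.Dtmin - κ₁)) := by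
  obtain ⟨hx, hy⟩ := abs_VXE_sub_bandVX_le B hδs hn (fun k _ => hδ k) hlo hhi (fun k _ => hκ k) hκ₁ hu θ
  set CV := κ₁ * (π * Real.sqrt 2 + 2 * B.smax) / (B.Dtmin - κ₁) with hCV
  have hid : p * bandVX (μ - δ (u θ • dir θ)) θ + q * bandVY (μ - δ (u θ • dir θ)) θ =
      (p * VXE u θ + q * VYE u θ) - (p * (VXE u θ - bandVX (μ - δ (u θ • dir θ)) θ) +
        q * (VYE u θ - bandVY (μ - δ (u θ • dir θ)) θ)) := by ring
  rw [hid]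
  refine (abs_sub _ _).trans (add_le_add le_rfl ?_)
  refine (abs_add_le _ _).trans ?_
  rw [abs_mul, abs_mul]
  have h1 : |p| * |VXE u θ - bandVX (μ - δ (u θ • dir θ)) θ| ≤ 1 * CV := mul_le_mul hp hx (abs_nonneg _) zero_le_one
  have h2 : |q| * |VYE u θ - bandVY (μ - δ (u θ • dir θ)) θ| ≤ 1 * CV := mul_le_mul hq hy (abs_nonneg _) zero_le_one
  linarith

/-- **One leg of the perturbed covering lemma**: if the momentum sum `S` (any reals `(SX, SY)` with `|ε₂(SX,SY) + δ S' - μ| ≤ η₀`-type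
closeness encoded as: the sines of `S` are within `e` of those of a free point `p_{μ'}(φ)`, `|μ' - ν| ≤ 2κ₀` for the leg's shifted level `ν`)
and `|∂ h^E| ≤ λ` in that leg, then the leg's angle is `≡ φ (mod π)` up to `C_g ε₄`. Stated for the leg at `θ` with the data as hypotheses.
[cite: BenfattoGiulianiMastropietro2006, App. A2] -/
theorem exists_int_near_of_h3E_small {SX SY φ μ' e lam : ℝ} (hμ' : μ' ∈ Icc a b)
    (hsx : |Real.sin SX - Real.sin (bandX μ' φ)| ≤ e) (hsy : |Real.sin SY - Real.sin (bandY μ' φ)| ≤ e) (θ : ℝ)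
    (hgap : |μ' - (μ - δ (u θ • dir θ))| ≤ 2 * κ₀) {S : Fin 2 → ℝ}
    (hd : |2 * Real.sin SX * VXE u θ + 2 * Real.sin SY * VYE u θ + fderiv ℝ δ S ![VXE u θ, VYE u θ]| ≤ lam) :
    ∃ j : ℤ, |φ - θ - j * π| ≤ B.Cg * (lam / 2 +
      κ₁ * (B.smax + κ₁ * (π * Real.sqrt 2 + 2 * B.smax) / (B.Dtmin - κ₁)) / 2 +
      2 * (κ₁ * (π * Real.sqrt 2 + 2 * B.smax) / (B.Dtmin - κ₁)) + 2 * B.smax * e + 2 * B.smax * (2 * κ₀ / B.Dtmin)) := by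
  set ν := μ - δ (u θ • dir θ) with hνdef
  have hν : ν ∈ Icc a b := shiftedLevel_mem_Icc (hu θ) (fun k _ => hδ k) hlo hhi
  set CV := κ₁ * (π * Real.sqrt 2 + 2 * B.smax) / (B.Dtmin - κ₁) with hCV
  set SE := B.smax + CV with hSE
  -- the `Dδ` term
  obtain ⟨hvx, hvy⟩ := abs_VXE_le B hδs hn (fun k _ => hδ k) hlo hhi (fun k _ => hκ k) hκ₁ hu θ
  have hSE0 : 0 ≤ SE := (abs_nonneg _).trans hvx
  have hD : |fderiv ℝ δ S ![VXE u θ, VYE u θ]| ≤ κ₁ * SE := abs_fderiv_vec2_le (hκ S) hSE0 hvx hvy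
  -- step 1: the perturbed cross quantity is small
  have h1 : |Real.sin SX * VXE u θ + Real.sin SY * VYE u θ| ≤ lam / 2 + κ₁ * SE / 2 := by
    have hid : Real.sin SX * VXE u θ + Real.sin SY * VYE u θ =
        ((2 * Real.sin SX * VXE u θ + 2 * Real.sin SY * VYE u θ + fderiv ℝ δ S ![VXE u θ, VYE u θ]) -
          fderiv ℝ δ S ![VXE u θ, VYE u θ]) / 2 := by ring
    rw [hid, abs_div, abs_two]
    have := abs_sub (2 * Real.sin SX * VXE u θ + 2 * Real.sin SY * VYE u θ + fderiv ℝ δ S ![VXE u θ, VYE u θ])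
      (fderiv ℝ δ S ![VXE u θ, VYE u θ])
    rw [div_le_iff₀ (by norm_num : (0:ℝ) < 2)]
    linarith
  -- step 2: free velocities at the shifted level `ν`
  have h2 : |Real.sin SX * bandVX ν θ + Real.sin SY * bandVY ν θ| ≤ lam / 2 + κ₁ * SE / 2 + 2 * CV :=
    (abs_cross_band_le_cross_E B hδs hn hδ hlo hhi hκ hκ₁ hu (Real.abs_sin_le_one SX) (Real.abs_sin_le_one SY) θ).trans
      (by linarith)
  -- step 3: sines of `S` → sines of the free point `p_{μ'}(φ)`
  have h3 : |Real.sin (bandX μ' φ) * bandVX ν θ + Real.sin (bandY μ' φ) * bandVY ν θ| ≤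
      lam / 2 + κ₁ * SE / 2 + 2 * CV + 2 * B.smax * e :=
    (cross_perturb B hν hsx hsy).trans (by linarith)
  -- step 4: level `μ'` → level `ν` in the sines at the angle `φ`
  have hrad := abs_bandFermiRadius_sub_le_of_level B hν hμ' φ
  have hgap' : |bandFermiRadius μ' φ - bandFermiRadius ν φ| ≤ 2 * κ₀ / B.Dtmin :=
    hrad.trans (div_le_div_of_nonneg_right hgap B.Dtmin_pos.le)
  have hsx' : |Real.sin (bandX μ' φ) - Real.sin (bandX ν φ)| ≤ 2 * κ₀ / B.Dtmin := by
    refine (Real.abs_sin_sub_sin_le _ _).trans ?_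
    rw [bandX, bandX, ← sub_mul, abs_mul]
    exact (mul_le_of_le_one_right (abs_nonneg _) (Real.abs_cos_le_one φ)).trans hgap'
  have hsy' : |Real.sin (bandY μ' φ) - Real.sin (bandY ν φ)| ≤ 2 * κ₀ / B.Dtmin := by
    refine (Real.abs_sin_sub_sin_le _ _).trans ?_
    rw [bandY, bandY, ← sub_mul, abs_mul]
    exact (mul_le_of_le_one_right (abs_nonneg _) (Real.abs_sin_le_one φ)).trans hgap'
  have h4 : |Real.sin (bandX ν φ) * bandVX ν θ + Real.sin (bandY ν φ) * bandVY ν θ| ≤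
      lam / 2 + κ₁ * SE / 2 + 2 * CV + 2 * B.smax * e + 2 * B.smax * (2 * κ₀ / B.Dtmin) :=
    (cross_perturb B hν hsx' hsy').trans (by linarith)
  -- step 5: the free Gauss-map lemma at the level `ν`
  exact exists_int_near_of_cross_small B hν h4

/-- **Covering lemma on the perturbed curve** (the tree's `cover` for `h^E`): if `|h^E_P(θ₂, θ₃)| ≤ η₀` and
`|∂₂ h^E|, |∂₃ h^E| ≤ λ`, with `μ ± (κ₀ + η₀)` in the level range and the smallness
`2 C_g ε₄ ≤ τ`, then `θ₃ ≡ θ₂ (mod π)` up to `τ`. [cite: BenfattoGiulianiMastropietro2006, App. A2] -/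
theorem cover_perturbed {P : ℝ × ℝ} {θ₂ θ₃ η₀ lam τ : ℝ} (hlo' : a ≤ μ - κ₀ - η₀) (hhi' : μ + κ₀ + η₀ ≤ b)
    (hh : |hfunE δ u μ P θ₂ θ₃| ≤ η₀) (hd2 : |h3E δ u P θ₃ θ₂| ≤ lam) (hd3 : |h3E δ u P θ₂ θ₃| ≤ lam)
    (hsmall : 2 * (B.Cg * (lam / 2 +
      κ₁ * (B.smax + κ₁ * (π * Real.sqrt 2 + 2 * B.smax) / (B.Dtmin - κ₁)) / 2 +
      2 * (κ₁ * (π * Real.sqrt 2 + 2 * B.smax) / (B.Dtmin - κ₁)) + 2 * B.smax * (η₀ / B.Dtmin) +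
      2 * B.smax * (2 * κ₀ / B.Dtmin))) ≤ τ) :
    ∃ j : ℤ, |θ₃ - θ₂ - j * π| ≤ τ := by
  set S := momE u P θ₂ θ₃ with hS
  set μ' := μ - δ S with hμ'def
  have hz := abs_le.1 (hδ S)
  have hη₀ : 0 ≤ η₀ := (abs_nonneg _).trans hh
  have hμ' : μ' ∈ Icc a b := ⟨by linarith [hz.2], by linarith [hz.1]⟩
  -- the momentum sum is `η₀`-close to the free curve of the level `μ'`
  have hh' : |eps2 (SXE u P θ₂ θ₃) (SYE u P θ₂ θ₃) - μ'| ≤ η₀ := by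
    have : eps2 (SXE u P θ₂ θ₃) (SYE u P θ₂ θ₃) - μ' = hfunE δ u μ P θ₂ θ₃ := by
      rw [hμ'def, hS, hfunE]; ring
    rw [this]; exact hh
  obtain ⟨φ, hsx, hsy, -, -⟩ := exists_near_curve_trig B hμ' hh' (by linarith [hz.2]) (by linarith [hz.1])
  -- level gaps `|μ' - νᵢ| ≤ 2κ₀`
  have hgap : ∀ θ, |μ' - (μ - δ (u θ • dir θ))| ≤ 2 * κ₀ := by
    intro θ
    have h1 := abs_le.1 (hδ (u θ • dir θ))
    rw [hμ'def, abs_le]; constructor <;> linarith [hz.1, hz.2]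
  -- leg 3
  have hd3' : |2 * Real.sin (SXE u P θ₂ θ₃) * VXE u θ₃ + 2 * Real.sin (SYE u P θ₂ θ₃) * VYE u θ₃ +
      fderiv ℝ δ S ![VXE u θ₃, VYE u θ₃]| ≤ lam := by rw [hS]; exact hd3
  obtain ⟨j₃, hj₃⟩ := exists_int_near_of_h3E_small B hδs hn hδ hlo hhi hκ hκ₁ hu hμ' hsx hsy θ₃ (hgap θ₃) hd3'
  -- leg 2 (the momentum sum is symmetric)
  have hd2' : |2 * Real.sin (SXE u P θ₂ θ₃) * VXE u θ₂ + 2 * Real.sin (SYE u P θ₂ θ₃) * VYE u θ₂ +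
      fderiv ℝ δ S ![VXE u θ₂, VYE u θ₂]| ≤ lam := by
    rw [hS, momE_swap, SXE_swap, SYE_swap]; exact hd2
  obtain ⟨j₂, hj₂⟩ := exists_int_near_of_h3E_small B hδs hn hδ hlo hhi hκ hκ₁ hu hμ' hsx hsy θ₂ (hgap θ₂) hd2'
  refine ⟨j₂ - j₃, ?_⟩
  have : θ₃ - θ₂ - ((j₂ - j₃ : ℤ) : ℝ) * π = (φ - θ₂ - j₂ * π) - (φ - θ₃ - j₃ * π) := by push_cast; ring
  rw [this]
  calc |(φ - θ₂ - j₂ * π) - (φ - θ₃ - j₃ * π)| ≤ |φ - θ₂ - j₂ * π| + |φ - θ₃ - j₃ * π| := abs_sub _ _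
    _ ≤ τ := by linarith [hj₂, hj₃, hsmall]

end Cover

end Summit.HubbardSuperconductivity.HubbardSuperconductivity.Theorems.PerturbedFermiCurve

end
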